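import Mathlib
import Summits.MatrixMultiplication.MatrixMultiplication.Theorems.SnSubsetDichotomyHyperoctahedralThresholdRotationIdentity

/-!
# Counted same-colour collisions avoiding a forbidden set
# (crux `HyperoctahedralThreshold`, stmt-MatrixMultiplication-10883; siege variation "supply/tip dichotomy")

Helper for the open core `stub_poorRigidCore` of the refutation line
(`Cruxes/HyperoctahedralThreshold/Lines/refutation_local_symmetry.lean`), reflection sub-route
(`Cruxes/HyperoctahedralThreshold/Lines/reflection_route_c3.{lean,md}`, crux NOTES §15).

Vocabulary.  Three involutions `μ b` of `Fin n` without fixed points; a colour word acts on the right,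
`x · w := w.foldl (fun v b => μ b v) x`.  For a word `w` of length `L` with `w ++ [c]` reduced, the involution word
`w c w⁻¹ := w ++ c :: w.reverse` moves every point.  An INCIDENCE is a pair `(v, w)`; it is `R`-FREE ("good") when all
trajectory points `v · (w c w⁻¹)_[t]` lie outside the forbidden set `R`.  Two good incidences `(v, w) ≠ (v, w')` with the
same image `v · w c w⁻¹ = v · w' c w'⁻¹` are a (same-colour, `R`-free) COLLISION — the raw material of an `R`-avoiding
same-colour reflection structure (sibling tree files `…SameColourCollision`, `…CleanReflection`, `…SameColourTip`).

What this file adds to the existential supply of `…SameColourCollision` / `…ReflectionSupply` (ONE collision) is the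
COUNTED form that a union-bound finish and the bouquet lemma (BQ)/(HC) of the reflection route consume:

* `sum_good_ge` — the bijection trick, counted: `2^L · n ≤ Σ_v #{good words at v} + 2^L (2L+2) |R|`.
* `card_le_card_add_card_collisions` — pigeonhole, counted: a map `s → t` has at least `#s − #t` ordered colliding pairs.
* `exists_goodCollisions` / **`stub_goodCollisionCount`** — for every colour `c` there is a finset `S` of `R`-free
  same-colour collisions `(v, w, w')`, `w ≠ w'`, with `2^L · n ≤ #S + n(n−1) + 2^L (2L+2) |R|`
  (so `#S ≥ (K − 1 − o(1))·n²` at `2^L = K n`, `|R| ≤ n^{3/4}`, `L = O(log n)`).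
(Pigeonhole with multiplicity on the same counted supply gives `R`-free BOUQUETS — hot rungs of reflection multiplicity
  `> M` whenever `n(n−1)·M + 2^L(2L+2)|R| < 2^L·n` —, registered separately as `stub_reflectionBouquet` by siege k15.)

Pure finite combinatorics (no hypothesis on `n`); no definitions are introduced.  Word-action lemmas
(`Rotation.foldl_act_injective`, `Rotation.foldl_reverse_act`) come from the tree file `…RotationIdentity` (p111510).
-/

set_option linter.dupNamespace false

namespace Summit.MatrixMultiplication.MatrixMultiplication.Theorems.HyperoctahedralThreshold.GoodCollisions

open Finset

variable {n : ℕ}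

-- construction adapted from the tree files …ReflectionSupply.lean (siege k19) / …SameColourCollision.lean (siege k1)
/-- **A family of `2^L` reduced words with prescribed forbidden final colour.**  There is an injective map `F` from
bit strings of length `L` to colour words of length `L` such that `F bs ++ [c]` is reduced for every `bs`
(take `F bs :=` the reversed tail of `List.scanl (fun x b => if b then x + 1 else x + 2) c bs`). -/
theorem family_spec_colour (L : ℕ) (c : Fin 3) : ∃ F : List.Vector Bool L → List (Fin 3), Function.Injective F ∧
    ∀ bs, (F bs).length = L ∧ List.IsChain (· ≠ ·) (F bs ++ [c]) := by
  have step_ne : ∀ (x : Fin 3) (b : Bool), (if b then x + 1 else x + 2) ≠ x := by decide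
  have step_inj : ∀ (x : Fin 3) (b b' : Bool),
      (if b then x + 1 else x + 2) = (if b' then x + 1 else x + 2) → b = b' := by decide
  have scanl_eq_cons : ∀ (a : Fin 3) (bs : List Bool),
      ∃ l, List.scanl (fun x b => if b then x + 1 else x + 2) a bs = a :: l := by
    intro a bs
    cases bs with
    | nil => exact ⟨[], by simp⟩
    | cons b bs => exact ⟨_, List.scanl_cons⟩
  have isChain_scanl : ∀ (bs : List Bool) (a : Fin 3),
      List.IsChain (· ≠ ·) (List.scanl (fun x b => if b then x + 1 else x + 2) a bs) := by
    intro bs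
    induction bs with
    | nil => intro a; simp
    | cons b bs ih =>
      intro a
      rw [List.scanl_cons]
      refine List.IsChain.cons (ih _) ?_
      intro y hy
      obtain ⟨l, hl⟩ := scanl_eq_cons (if b then a + 1 else a + 2) bs
      rw [hl] at hy
      simp only [List.head?_cons, Option.mem_def, Option.some.injEq] at hy
      rw [← hy]
      exact (step_ne a b).symm
  have scanl_injective : ∀ (bs bs' : List Bool) (a : Fin 3),
      List.scanl (fun x b => if b then x + 1 else x + 2) a bs =
        List.scanl (fun x b => if b then x + 1 else x + 2) a bs' → bs = bs' := by
    intro bs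
    induction bs with
    | nil =>
      intro bs' a h
      cases bs' with
      | nil => rfl
      | cons b' bs' =>
        have := congrArg List.length h
        simp [List.length_scanl] at this
    | cons b bs ih =>
      intro bs' a h
      cases bs' with
      | nil =>
        have := congrArg List.length h
        simp [List.length_scanl] at this
      | cons b' bs' =>
        rw [List.scanl_cons, List.scanl_cons] at h
        have htl := List.tail_eq_of_cons_eq h
        obtain ⟨l, hl⟩ := scanl_eq_cons (if b then a + 1 else a + 2) bs
        obtain ⟨l', hl'⟩ := scanl_eq_cons (if b' then a + 1 else a + 2) bs'
        have hhd : (if b then a + 1 else a + 2) = (if b' then a + 1 else a + 2) := by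
          have := congrArg List.head? htl
          rw [hl, hl'] at this
          simpa using this
        have hb : b = b' := step_inj a b b' hhd
        subst hb
        rw [ih bs' _ htl]
  refine ⟨fun bs => (List.scanl (fun x b => if b then x + 1 else x + 2) c bs.toList).tail.reverse, ?_, ?_⟩
  · intro bs bs' h
    obtain ⟨l, hl⟩ := scanl_eq_cons c bs.toList
    obtain ⟨l', hl'⟩ := scanl_eq_cons c bs'.toList
    have h1 := congrArg List.reverse h
    simp only [List.reverse_reverse] at h1
    rw [hl, hl'] at h1
    simp only [List.tail_cons] at h1
    subst h1
    exact List.Vector.toList_injective (scanl_injective _ _ _ (hl.trans hl'.symm))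
  · intro bs
    beta_reduce
    obtain ⟨l, hl⟩ := scanl_eq_cons c bs.toList
    have hc := isChain_scanl bs.toList c
    have hlen : (List.scanl (fun x b => if b then x + 1 else x + 2) c bs.toList).length = L + 1 := by
      rw [List.length_scanl, bs.toList_length]
    rw [hl] at hc hlen ⊢
    refine ⟨?_, ?_⟩
    · simp only [List.tail_cons, List.length_reverse]
      simpa using hlen
    · have : (c :: l).tail.reverse ++ [c] = (c :: l).reverse := by simp
      rw [this, List.isChain_reverse]
      exact hc.imp (fun a b h => fun h' => h h'.symm)

/-- **Bijection trick, counted.**  For any family `ι` of `2^L` words of length `2L+1` (indexed by bit strings), the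
incidences `(v, bs)` whose trajectory `t ↦ v · (ι bs)_[t]` meets `R` number at most `2^L (2L+2) |R|` (for fixed `bs, t`
the `t`-th point is an injective function of `v`), hence the `R`-free ones number at least `2^L · n − 2^L (2L+2) |R|`. -/
theorem sum_good_ge (μ : Fin 3 → Equiv.Perm (Fin n)) (hμ : ∀ c, μ c * μ c = 1) {L : ℕ} (R : Finset (Fin n))
    (ι : List.Vector Bool L → List (Fin 3)) :
    2 ^ L * n ≤ (∑ v : Fin n, ((Finset.univ : Finset (List.Vector Bool L)).filter
        (fun bs => ∀ t < 2 * L + 2, ((ι bs).take t).foldl (fun v c => μ c v) v ∉ R)).card) +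
      2 ^ L * ((2 * L + 2) * R.card) := by
  classical
  set good : Fin n → List.Vector Bool L → Prop := fun v bs =>
    ∀ t < 2 * L + 2, ((ι bs).take t).foldl (fun v c => μ c v) v ∉ R with hgood
  -- (1) bijection trick: for fixed `bs, t` at most `|R|` starting points have their `t`-th point in `R`
  have hfib : ∀ (bs : List.Vector Bool L) (t : ℕ),
      ((Finset.univ : Finset (Fin n)).filter
        (fun v => ((ι bs).take t).foldl (fun v c => μ c v) v ∈ R)).card ≤ R.card := by
    intro bs t
    refine Finset.card_le_card_of_injOn (fun v => ((ι bs).take t).foldl (fun v c => μ c v) v) ?_ ?_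
    · intro v hv
      simpa using hv
    · intro v _ v' _ hvv'
      exact Rotation.foldl_act_injective μ hμ _ hvv'
  -- (2) the bad incidences are few in total
  have hbad : ∑ v : Fin n, ((Finset.univ : Finset (List.Vector Bool L)).filter (fun bs => ¬ good v bs)).card
      ≤ 2 ^ L * ((2 * L + 2) * R.card) := by
    calc ∑ v : Fin n, ((Finset.univ : Finset (List.Vector Bool L)).filter (fun bs => ¬ good v bs)).card
        ≤ ∑ v : Fin n, ∑ bs : List.Vector Bool L, ∑ t ∈ Finset.range (2 * L + 2),
            (if ((ι bs).take t).foldl (fun v c => μ c v) v ∈ R then 1 else 0) := by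
          refine Finset.sum_le_sum fun v _ => ?_
          rw [Finset.card_filter]
          refine Finset.sum_le_sum fun bs _ => ?_
          by_cases hb : ¬ good v bs
          · rw [if_pos hb]
            simp only [hgood, not_forall, not_not, exists_prop] at hb
            obtain ⟨t, ht, htR⟩ := hb
            have h1 := Finset.single_le_sum (f := fun t =>
              if ((ι bs).take t).foldl (fun v c => μ c v) v ∈ R then 1 else 0)
              (fun _ _ => Nat.zero_le _) (Finset.mem_range.2 ht)
            rw [if_pos htR] at h1
            exact h1
          · rw [if_neg hb]
            exact Nat.zero_le _
      _ = ∑ bs : List.Vector Bool L, ∑ t ∈ Finset.range (2 * L + 2), ∑ v : Fin n,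
            (if ((ι bs).take t).foldl (fun v c => μ c v) v ∈ R then 1 else 0) := by
          rw [Finset.sum_comm]
          exact Finset.sum_congr rfl fun bs _ => Finset.sum_comm
      _ ≤ ∑ bs : List.Vector Bool L, ∑ t ∈ Finset.range (2 * L + 2), R.card := by
          refine Finset.sum_le_sum fun bs _ => Finset.sum_le_sum fun t _ => ?_
          rw [← Finset.card_filter]
          exact hfib bs t
      _ = 2 ^ L * ((2 * L + 2) * R.card) := by
          simp [Finset.sum_const, Finset.card_univ, card_vector, Fintype.card_bool]
  -- (3) good + bad = all
  have hsplit : ∀ v : Fin n,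
      ((Finset.univ : Finset (List.Vector Bool L)).filter (fun bs => good v bs)).card +
        ((Finset.univ : Finset (List.Vector Bool L)).filter (fun bs => ¬ good v bs)).card = 2 ^ L := by
    intro v
    rw [Finset.card_filter_add_card_filter_not, Finset.card_univ, card_vector, Fintype.card_bool]
  have htot : ∑ v : Fin n, (2 ^ L) =
      ∑ v : Fin n, ((Finset.univ : Finset (List.Vector Bool L)).filter (fun bs => good v bs)).card +
        ∑ v : Fin n, ((Finset.univ : Finset (List.Vector Bool L)).filter (fun bs => ¬ good v bs)).card := by
    rw [← Finset.sum_add_distrib]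
    exact Finset.sum_congr rfl fun v _ => (hsplit v).symm
  have hn : ∑ v : Fin n, (2 ^ L) = 2 ^ L * n := by
    simp [Finset.sum_const, Finset.card_univ, Fintype.card_fin, mul_comm]
  change 2 ^ L * n ≤ (∑ v : Fin n, ((Finset.univ : Finset (List.Vector Bool L)).filter
      (fun bs => good v bs)).card) + 2 ^ L * ((2 * L + 2) * R.card)
  omega

/-- **Pigeonhole, counted.**  A map `f` from `s` into `t` has at least `#s − #t` ordered pairs `(a, b)` of distinct
elements of `s` with `f a = f b` (fix a representative in each non-empty fibre; every other element pairs with the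
representative of its fibre). -/
theorem card_le_card_add_card_collisions {α β : Type*} [DecidableEq α] [DecidableEq β] (s : Finset α) (t : Finset β)
    (f : α → β) (hf : ∀ a ∈ s, f a ∈ t) :
    s.card ≤ t.card + ((s ×ˢ s).filter (fun p => p.1 ≠ p.2 ∧ f p.1 = f p.2)).card := by
  classical
  rcases s.eq_empty_or_nonempty with rfl | ⟨a₀, -⟩
  · simp
  haveI : Nonempty α := ⟨a₀⟩
  -- a representative for every value in the image
  have hrep : ∀ y ∈ s.image f, ∃ a ∈ s, f a = y := fun y hy => by simpa using Finset.mem_image.1 hy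
  choose! r hr using hrep
  -- split `s` into representatives and the rest
  set reps := s.filter (fun a => r (f a) = a) with hreps
  set rest := s.filter (fun a => r (f a) ≠ a) with hrest
  have hsplit : reps.card + rest.card = s.card := by
    rw [hreps, hrest]
    exact Finset.card_filter_add_card_filter_not (fun a => r (f a) = a)
  -- representatives inject into `t` via `f`
  have h1 : reps.card ≤ t.card := by
    refine Finset.card_le_card_of_injOn f ?_ ?_
    · intro a ha
      exact hf a (Finset.mem_filter.1 ha).1
    · intro a ha b hb hab
      have ha' := (Finset.mem_filter.1 (Finset.mem_coe.1 ha)).2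
      have hb' := (Finset.mem_filter.1 (Finset.mem_coe.1 hb)).2
      rw [← ha', ← hb', hab]
  -- the rest injects into the colliding pairs via `a ↦ (a, r (f a))`
  have h2 : rest.card ≤ ((s ×ˢ s).filter (fun p => p.1 ≠ p.2 ∧ f p.1 = f p.2)).card := by
    refine Finset.card_le_card_of_injOn (fun a => (a, r (f a))) ?_ ?_
    · intro a ha
      obtain ⟨has, hne⟩ := Finset.mem_filter.1 ha
      have hy : f a ∈ s.image f := Finset.mem_image_of_mem f has
      obtain ⟨hrs, hrf⟩ := hr (f a) hy
      simp only [Finset.coe_filter, Set.mem_setOf_eq, Finset.mem_product]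
      exact ⟨⟨has, hrs⟩, fun h => hne h.symm, hrf.symm⟩
    · intro a _ b _ hab
      exact congrArg Prod.fst hab
  omega

/-- **Counted `R`-free same-colour collisions.**  For every colour `c` and radius `L` there is a finset `S` of triples
`(v, w, w')` — two DISTINCT words of length `L` (`w ++ [c]`, `w' ++ [c]` reduced) whose involution words of colour `c`
collide at `v`, `v · (w c w⁻¹) = v · (w' c w'⁻¹)`, every trajectory point of both from `v` outside `R` — with
`2^L · n ≤ #S + n(n−1) + 2^L (2L+2) |R|`. -/
theorem exists_goodCollisions (μ : Fin 3 → Equiv.Perm (Fin n)) (hμ : ∀ c, μ c * μ c = 1)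
    (hfpf : ∀ c v, μ c v ≠ v) (L : ℕ) (R : Finset (Fin n)) (c : Fin 3) :
    ∃ S : Finset (Fin n × List (Fin 3) × List (Fin 3)),
      2 ^ L * n ≤ S.card + (n * (n - 1) + 2 ^ L * ((2 * L + 2) * R.card)) ∧
      ∀ p ∈ S, p.2.1 ≠ p.2.2 ∧ p.2.1.length = L ∧ p.2.2.length = L ∧
        List.IsChain (· ≠ ·) (p.2.1 ++ [c]) ∧ List.IsChain (· ≠ ·) (p.2.2 ++ [c]) ∧
        (p.2.1 ++ c :: p.2.1.reverse).foldl (fun v b => μ b v) p.1 =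
          (p.2.2 ++ c :: p.2.2.reverse).foldl (fun v b => μ b v) p.1 ∧
        (∀ t, ((p.2.1 ++ c :: p.2.1.reverse).take t).foldl (fun v b => μ b v) p.1 ∉ R) ∧
        (∀ t, ((p.2.2 ++ c :: p.2.2.reverse).take t).foldl (fun v b => μ b v) p.1 ∉ R) := by
  classical
  obtain ⟨F, hFinj, hF⟩ := family_spec_colour L c
  -- involution words move every point (they act as conjugates of `μ c`)
  have hmove : ∀ (w : List (Fin 3)) (v : Fin n), (w ++ c :: w.reverse).foldl (fun v b => μ b v) v ≠ v := by
    intro w v h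
    rw [List.foldl_append, List.foldl_cons] at h
    have h' := congrArg (fun x => w.foldl (fun v b => μ b v) x) h
    simp only [Rotation.foldl_reverse_act μ hμ] at h'
    exact hfpf c _ h'
  set ι : List.Vector Bool L → List (Fin 3) := fun bs => F bs ++ c :: (F bs).reverse with hι
  have hιlen : ∀ bs, (ι bs).length = 2 * L + 1 := by
    intro bs
    simp only [hι, List.length_append, List.length_cons, List.length_reverse, (hF bs).1]
    omega
  set good : Fin n → List.Vector Bool L → Prop := fun v bs =>
    ∀ t < 2 * L + 2, ((ι bs).take t).foldl (fun v c => μ c v) v ∉ R with hgood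
  set img : Fin n → List.Vector Bool L → Fin n := fun v bs => (ι bs).foldl (fun v c => μ c v) v with himg
  -- from the first `2L+2` points to all `t`
  have hall : ∀ v bs, good v bs → ∀ t, ((ι bs).take t).foldl (fun v c => μ c v) v ∉ R := by
    intro v bs hg t
    by_cases ht : t < 2 * L + 2
    · exact hg t ht
    · have h1 : (ι bs).take t = ι bs := List.take_of_length_le (by rw [hιlen]; omega)
      have h2 : (ι bs).take (2 * L + 1) = ι bs := List.take_of_length_le (by rw [hιlen])
      rw [h1, ← h2]
      exact hg (2 * L + 1) (by omega)
  -- counted supply of good incidences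
  have hsum := sum_good_ge μ hμ R ι
  -- per vertex: good words, and the colliding ordered pairs among them
  set G : Fin n → Finset (List.Vector Bool L) :=
    fun v => (Finset.univ : Finset (List.Vector Bool L)).filter (fun bs => good v bs) with hG
  set P : Fin n → Finset (List.Vector Bool L × List.Vector Bool L) :=
    fun v => (G v ×ˢ G v).filter (fun p => p.1 ≠ p.2 ∧ img v p.1 = img v p.2) with hP
  have hPv : ∀ v, (G v).card ≤ (n - 1) + (P v).card := by
    intro v
    have hmaps : ∀ bs ∈ G v, img v bs ∈ (Finset.univ : Finset (Fin n)).erase v := by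
      intro bs _
      rw [Finset.mem_erase]
      exact ⟨hmove _ _, Finset.mem_univ _⟩
    have h := card_le_card_add_card_collisions (G v) ((Finset.univ : Finset (Fin n)).erase v) (img v) hmaps
    rw [Finset.card_erase_of_mem (Finset.mem_univ v), Finset.card_univ, Fintype.card_fin] at h
    exact h
  -- global: the sigma-set of all colliding pairs
  set S₀ : Finset (Σ _ : Fin n, List.Vector Bool L × List.Vector Bool L) :=
    (Finset.univ : Finset (Fin n)).sigma P with hS₀
  have hS₀card : S₀.card = ∑ v : Fin n, (P v).card := Finset.card_sigma _ _
  have hGsum : ∑ v : Fin n, (G v).card ≤ n * (n - 1) + S₀.card := by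
    calc ∑ v : Fin n, (G v).card ≤ ∑ v : Fin n, ((n - 1) + (P v).card) := Finset.sum_le_sum fun v _ => hPv v
      _ = n * (n - 1) + S₀.card := by
        rw [Finset.sum_add_distrib, hS₀card]
        simp [Finset.sum_const, Finset.card_univ, Fintype.card_fin]
  -- push forward to words
  set φ : (Σ _ : Fin n, List.Vector Bool L × List.Vector Bool L) → Fin n × List (Fin 3) × List (Fin 3) :=
    fun q => (q.1, F q.2.1, F q.2.2) with hφ
  have hφinj : Function.Injective φ := by
    rintro ⟨v, bs, bs'⟩ ⟨v₁, bs₁, bs₁'⟩ h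
    simp only [hφ, Prod.mk.injEq] at h
    obtain ⟨rfl, h2, h3⟩ := h
    have := hFinj h2
    have := hFinj h3
    subst bs₁; subst bs₁'
    rfl
  refine ⟨S₀.image φ, ?_, ?_⟩
  · rw [Finset.card_image_of_injective _ hφinj]
    have : ∑ v : Fin n, (G v).card = ∑ v : Fin n, ((Finset.univ : Finset (List.Vector Bool L)).filter
        (fun bs => ∀ t < 2 * L + 2, ((ι bs).take t).foldl (fun v c => μ c v) v ∉ R)).card := rfl
    omega
  · intro p hp
    rw [Finset.mem_image] at hp
    obtain ⟨⟨v, bs, bs'⟩, hq, rfl⟩ := hp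
    rw [hS₀, Finset.mem_sigma] at hq
    obtain ⟨-, hq⟩ := hq
    rw [hP, Finset.mem_filter, Finset.mem_product] at hq
    obtain ⟨⟨hbs, hbs'⟩, hne, heq⟩ := hq
    rw [hG, Finset.mem_filter] at hbs hbs'
    refine ⟨fun h => hne (hFinj h), (hF bs).1, (hF bs').1, (hF bs).2, (hF bs').2, heq, hall v bs hbs.2,
      hall v bs' hbs'.2⟩

/-- **Registered form** (`stub_goodCollisionCount`, a `--supports` sub-goal of crux stmt-MatrixMultiplication-10883,
siege variation "supply/tip dichotomy"): verbatim `exists_goodCollisions`. -/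
theorem stub_goodCollisionCount : ∀ (n L : ℕ) (μ : Fin 3 → Equiv.Perm (Fin n)) (R : Finset (Fin n)) (c : Fin 3), (∀ b, μ b * μ b = 1) → (∀ b v, μ b v ≠ v) → ∃ S : Finset (Fin n × List (Fin 3) × List (Fin 3)), 2 ^ L * n ≤ S.card + (n * (n - 1) + 2 ^ L * ((2 * L + 2) * R.card)) ∧ ∀ p ∈ S, p.2.1 ≠ p.2.2 ∧ p.2.1.length = L ∧ p.2.2.length = L ∧ List.IsChain (· ≠ ·) (p.2.1 ++ [c]) ∧ List.IsChain (· ≠ ·) (p.2.2 ++ [c]) ∧ (p.2.1 ++ c :: p.2.1.reverse).foldl (fun v b => μ b v) p.1 = (p.2.2 ++ c :: p.2.2.reverse).foldl (fun v b => μ b v) p.1 ∧ (∀ t, ((p.2.1 ++ c :: p.2.1.reverse).take t).foldl (fun v b => μ b v) p.1 ∉ R) ∧ (∀ t, ((p.2.2 ++ c :: p.2.2.reverse).take t).foldl (fun v b => μ b v) p.1 ∉ R) :=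
  fun _n L μ R c hμ hfpf => exists_goodCollisions μ hμ hfpf L R c

end Summit.MatrixMultiplication.MatrixMultiplication.Theorems.HyperoctahedralThreshold.GoodCollisions
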